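import Literature.MathematicalPhysics.QuantumFieldTheory.Balaban1983to89.B8TowerBondsLayerLawOfLam

/-!
# [B8] (1.5) ⇒ THE CONSTRAINT TOWERS OF A LAWFUL ADMISSIBLE MEMBER ARE PAIRWISE DISJOINT — the `ZdIdx` edition of the layer law `TowerDisjoint`
# (`B8Prop5LandauIdxLayer`), DERIVED from print's (1.5) corner reading `LamTop` + the admissibility record `DomainSeq` + the located laws №8 ∕ `htower`;
# the READ-23 ∕ LOCATED-SLET vacuity mechanism («Λ₀ = ℤᵈ ∧ Λ₁ ≠ ∅») is EXCLUDED by that reading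

Cell `pub-ymgap`, seat `pub-ymgap-dag-n05-c` generation 15 (R134 N05 [B8] s1; class ∕ law owner).  Trigger: dag-n05-w1 g2 LOCATED-SLET (bus 2026-08-28 07:16Z):
the [4]-letters binders `SLet ∕ SLetUB` of the N05 knits, keyed on `i.Ω 0 = ℤᵈ → IdxB8LawsB θ.L i → DomainSeq θ.L i.Ω → …`, are UNSATISFIABLE as typed — the all-`univ`
datum `i⋆` (`k = 1`, `Ω_j = Λs m j = ℤᵈ`) obeys every located law and kills the right-inverse letter `H′` («`Q′_j(H′Y)(y) = Y(j, y)` on ALL of `Λ₀ = ℤᵈ` AND on `Λ₁ ≠ ∅`»: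
ref-A g15 READ-23's mechanism); «the repair letter is n05-c's».  This seat's DESIGN WORD (bus 07:24Z): the repair letter is print's (1.5) AS ALREADY TYPED, top
truncation, corner reading — `LamTop` ≡ `∀ j < i.k, ∀ z ∈ i.Λs i.k j, Lʲ•z ∈ B8ConstraintBonds.Lam L i.Ω j` (dag-n05-w2's hypothesis text `hΛ` of
`B8TowerBondsLayerLawOfLam.layer_member_of_lamTop`, inhabited at print's cube towers by `lamTop_cubeLamS`) — conjoined AT THE BINDER like `DomainSeq`.  THIS FILE is the
mechanism that makes the word honest: `LamTop` + `DomainSeq` + `IdxB8Laws` ⇒ the towers `{Bʲ(z) : j ≤ m, z ∈ Λs m j}` of EVERY truncation `m ≤ k` are PAIRWISE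
DISJOINT (cross-level: a common fine site `x ∈ Bʲ(z) ∩ Bʲ′(z′)`, `j < j′`, lies in `Ω_{j′} ⊆ Ω_{j+1}` by the tower law `IdxB8Laws.tower_all` and nesting, while (1.5) at
the top `z` (`Λs m j = Λs k j` below the diagonal, №8) and the saturation of `Ω_{j+1}` put the whole `j`-block of `z` OUTSIDE `Ω_{j+1}` — dag-n05-w2's
`not_mem_succ_of_under`; same level: the labels agree) — exactly the independence of the `H′`-constraints; and the READ-23 shape «`Λs k 0 = ℤᵈ` with a level-1 top»
(in particular `i⋆`) is EXCLUDED.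
[B8] = [Balaban1985RegularSpaces] (1.3)–(1.6) p. 77, (1.19) p. 79, (1.34) p. 82, (1.91)–(1.92) p. 91 (`Q′H′ = I`); [4] = [Balaban1985BackgroundPropagators] p. 394 (`𝔅_k`).

CONTENTS.  §1 ★★ `towers_disjoint_of_lamTop` (every truncation `m ≤ k`, `Under` spelling), `towers_disjoint_top_of_lamTop` (`m = k`), the tower-box spelling
`towers_disjoint_of_lamTop_inBox` (`InBox (tlo L z j) (thi L z j) x`, the text of `ZdIdx.htower` ∕ `ZdLanIdx.TowerDisjoint`) and the block-label spelling
`towers_disjoint_of_lamTop_blockMap` (`blockMap (Lʲ) x = z`, the text of `Q′_j` readers).  §2 THE EXCLUDED SHAPES: ★ `not_lamTop_of_univ_zero_of_top_one` (under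
`DomainSeq` + `IdxB8Laws`, `LamTop` forbids «`Λs k 0 = ℤᵈ` together with a level-`1` top», READ-23's mechanism), `not_lamTop_of_omega_one_univ` (no hypothesis beyond the
datum: `Ω₁ = ℤᵈ` with a level-`0` top violates `LamTop` — LOCATED-SLET's `i⋆`).
REUSED BY NAME: `B8TowerBondsLayerLawOfLam.not_mem_succ_of_under`, `B8IdxB8LawsCoverZero.lamS_below_eq_top`, `Node00.IdxB8Laws.tower_all`, `B8ConstraintBonds.DomainSeq.anti_le ∕
Lam`, `B8Eq191FlatLettersCubeMember.under_iff_blockMap_eq ∕ under_smul_self`, `B8CubeMemberZd.inBox_tower_iff_under`.  A6: the three hypotheses are jointly inhabited at every depth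
by print's own towers — `B8TowerBondsLayerLawOfLam.exists_member_layerLaw` (`{□_j}`) — and the conclusion there is dag-n05-e's `B8Eq191FlatLettersCubeMember.towers_disjoint_cube`
(not restated).

HONEST FRAMING.  A typing-law consequence, lattice bookkeeping only; it removes the located obstruction to the letters binders and asserts NOTHING about the EXISTENCE of
[4]'s letters at such members ([Balaban1985BackgroundPropagators] Thm 3.1 — N06's business); no estimate; no definition; count-neutral; N05 ∕ N06 NOT discharged; one
finite 𝕋⁴ programme at fixed `ε = L^{−K}`, Bałaban AS PRINTED — nothing continuum ∕ ℝ⁴ ∕ OS ∕ mass-gap ∕ Clay.  No `sorry`, no `instance`, no `notation`; standard axioms.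
-/

namespace Literature.MathematicalPhysics.QuantumFieldTheory.Balaban1983to89.B8IdxB8LamTopTowerDisjoint

open Literature.MathematicalPhysics.QuantumLattice (blockMap)
open B7Prop1Explicit B7Prop1Local B8Ineq130
open B8Ineq132 (Under)
open B8LeafModelZd (ZdIdx)
open B8ConstraintBonds (DomainSeq Lam)
open B8Eq191FlatLettersCubeMember (under_iff_blockMap_eq under_smul_self)
open B8IdxB8LawsCoverZero (lamS_below_eq_top)
open B8TowerBondsLayerLawOfLam (not_mem_succ_of_under)
open B8CubeMemberZd (inBox_tower_iff_under)
open Node00 (IdxB8Laws)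

-- `Site` alone could resolve to the torus sites of `Setup.lean`; re-export the `ℤ^d` sites of `B7Prop1Explicit`.
export B7Prop1Explicit (Site)

variable {d : ℕ} {L : ℕ}

/-! ## §1 Pairwise disjointness of the constraint towers from (1.5) -/

/-- The cross-level step: under `LamTop` + `DomainSeq` + the located laws, NO fine site lies under a top `z ∈ Λs m j` AND under a top `z′ ∈ Λs m j′` with
`j < j′ ≤ m ≤ k` — it would lie in `Ω_{j′} ⊆ Ω_{j+1}` (tower law + nesting) and outside `Ω_{j+1}` ((1.5) at the top `z` + saturation). (private step)
[cite: Balaban1985RegularSpaces, (1.3)–(1.5) p.77, (1.19) p.79, (1.34) p.82] -/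
private theorem towers_lt_disjoint_of_lamTop (hL : 1 ≤ L) (i : ZdIdx d L) (hlaws : IdxB8Laws L i) (hΩ : DomainSeq L i.Ω)
    (hΛ : ∀ j, j < i.k → ∀ z ∈ i.Λs i.k j, ((L : ℤ) ^ j) • z ∈ Lam L i.Ω j) {m : ℕ} (hm : m ≤ i.k) {j j' : ℕ} (hjj' : j < j')
    (hj' : j' ≤ m) {z z' x : Site d} (hz : z ∈ i.Λs m j) (hz' : z' ∈ i.Λs m j') (hx : Under L j z x) (hx' : Under L j' z' x) : False := by
  have hjm : j < m := lt_of_lt_of_le hjj' hj'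
  -- (1.5) at the top `z`: the `j`-block of `z` avoids `Ω_{j+1}`
  rw [lamS_below_eq_top hlaws hjm hm] at hz
  have hout : x ∉ i.Ω (j + 1) := not_mem_succ_of_under hL hΩ (hΛ j (lt_of_lt_of_le hjm hm) z hz).2.2 hx
  -- the tower law at `(m, j′, z′)`: `x ∈ Ω_{j′} ⊆ Ω_{j+1}`
  have hin : x ∈ i.Ω j' := hlaws.tower_all m hm j' hj' z' hz' x ((inBox_tower_iff_under L j' z' x).2 hx')
  exact hout (hΩ.anti_le (Nat.succ_le_of_lt hjj') hin)

/-- ★★ **THE CONSTRAINT TOWERS OF EVERY TRUNCATION ARE PAIRWISE DISJOINT** ((1.5) ⇒ the layer law, `ZdIdx` edition): for `i : ZdIdx d L` with the located laws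
`IdxB8Laws L i` (№8 truncation + the tower law), an admissible domain sequence `DomainSeq L i.Ω` ((1.3)–(1.4) as typed) and the (1.5)-reading `LamTop` of the top tower
(«`z ∈ Λs k j`, `j < k` ⇒ `Lʲ•z ∈ Λ_j = Ω_j^{(j)} ∖ Ω_{j+1}^{(j)}`»), at every truncation `m ≤ k` a fine site under two tops `z ∈ Λs m j`, `z′ ∈ Λs m j′` (`j, j′ ≤ m`)
forces `j = j′` and `z = z′` — the towers `{Bʲ(z)}` over `𝔅_m` PARTITION their union, so the right-inverse constraints `Q′_j(H′Y)(z) = Y(j, z)` of (1.91)–(1.92) are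
independent. (`L ≥ 1`.) [cite: Balaban1985RegularSpaces, (1.5)–(1.6) p.77 («Λ_j = Ω_j^{(j)} ∖ Ω_{j+1}^{(j)}», «Ω = ⋃_j Bʲ(Λ_j)»), (1.19) p.79, (1.34) p.82, (1.91)–(1.92) p.91; Balaban1985BackgroundPropagators, p.394 (𝔅_k)] -/
theorem towers_disjoint_of_lamTop (hL : 1 ≤ L) (i : ZdIdx d L) (hlaws : IdxB8Laws L i) (hΩ : DomainSeq L i.Ω)
    (hΛ : ∀ j, j < i.k → ∀ z ∈ i.Λs i.k j, ((L : ℤ) ^ j) • z ∈ Lam L i.Ω j) :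
    ∀ m, m ≤ i.k → ∀ j, j ≤ m → ∀ j', j' ≤ m → ∀ z ∈ i.Λs m j, ∀ z' ∈ i.Λs m j', ∀ x,
      Under L j z x → Under L j' z' x → j = j' ∧ z = z' := by
  intro m hm j hj j' hj' z hz z' hz' x hx hx'
  rcases lt_trichotomy j j' with hlt | heq | hgt
  · exact absurd (towers_lt_disjoint_of_lamTop hL i hlaws hΩ hΛ hm hlt hj' hz hz' hx hx') id
  · subst heq
    exact ⟨rfl, ((under_iff_blockMap_eq hL j z x).1 hx).symm.trans ((under_iff_blockMap_eq hL j z' x).1 hx')⟩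
  · exact absurd (towers_lt_disjoint_of_lamTop hL i hlaws hΩ hΛ hm hgt hj hz' hz hx' hx) id

/-- ★ **AT THE TOP TRUNCATION** `m = k` (the structure the letters binder reads: `∀ n ≤ i.k, y ∈ i.Λs i.k n`): the towers over `𝔅_k` are pairwise disjoint.
[cite: Balaban1985RegularSpaces, (1.5)–(1.6) p.77, (1.91)–(1.92) p.91; Balaban1985BackgroundPropagators, p.394 (𝔅_k)] -/
theorem towers_disjoint_top_of_lamTop (hL : 1 ≤ L) (i : ZdIdx d L) (hlaws : IdxB8Laws L i) (hΩ : DomainSeq L i.Ω)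
    (hΛ : ∀ j, j < i.k → ∀ z ∈ i.Λs i.k j, ((L : ℤ) ^ j) • z ∈ Lam L i.Ω j) :
    ∀ j, j ≤ i.k → ∀ j', j' ≤ i.k → ∀ z ∈ i.Λs i.k j, ∀ z' ∈ i.Λs i.k j', ∀ x,
      Under L j z x → Under L j' z' x → j = j' ∧ z = z' :=
  towers_disjoint_of_lamTop hL i hlaws hΩ hΛ i.k le_rfl

/-- **Tower-box spelling** (`InBox (tlo L z j) (thi L z j) x`, the text of `ZdIdx.htower` and of `B8Prop5LandauIdxLayer`'s `ZdLanIdx.TowerDisjoint`): every truncation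
`m ≤ k`. [cite: Balaban1985RegularSpaces, (1.5)–(1.6) p.77, (1.19) p.79, (1.34) p.82] -/
theorem towers_disjoint_of_lamTop_inBox (hL : 1 ≤ L) (i : ZdIdx d L) (hlaws : IdxB8Laws L i) (hΩ : DomainSeq L i.Ω)
    (hΛ : ∀ j, j < i.k → ∀ z ∈ i.Λs i.k j, ((L : ℤ) ^ j) • z ∈ Lam L i.Ω j) :
    ∀ m, m ≤ i.k → ∀ j, j ≤ m → ∀ j', j' ≤ m → ∀ z ∈ i.Λs m j, ∀ z' ∈ i.Λs m j', ∀ x,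
      InBox (tlo L z j) (thi L z j) x → InBox (tlo L z' j') (thi L z' j') x → j = j' ∧ z = z' :=
  fun m hm j hj j' hj' z hz z' hz' x hx hx' =>
    towers_disjoint_of_lamTop hL i hlaws hΩ hΛ m hm j hj j' hj' z hz z' hz' x
      ((inBox_tower_iff_under L j z x).1 hx) ((inBox_tower_iff_under L j' z' x).1 hx')

/-- **Block-label spelling** (`blockMap (Lʲ) x = z`, the text of the `Q′_j` readers — `B8Eq191FlatLettersDirichlet` ∕ `B9Eq325QprimeSingleSiteZd`): at every truncation
`m ≤ k`, a fine site whose level-`j` and level-`j′` block labels are tops of `Λs m` at those levels sees ONE constraint point.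
[cite: Balaban1985RegularSpaces, (1.5)–(1.6) p.77; Balaban1985BackgroundPropagators, (3.18)–(3.19) p.393, p.394 (𝔅_k)] -/
theorem towers_disjoint_of_lamTop_blockMap (hL : 1 ≤ L) (i : ZdIdx d L) (hlaws : IdxB8Laws L i) (hΩ : DomainSeq L i.Ω)
    (hΛ : ∀ j, j < i.k → ∀ z ∈ i.Λs i.k j, ((L : ℤ) ^ j) • z ∈ Lam L i.Ω j) :
    ∀ m, m ≤ i.k → ∀ j, j ≤ m → ∀ j', j' ≤ m → ∀ z ∈ i.Λs m j, ∀ z' ∈ i.Λs m j', ∀ x,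
      blockMap (L ^ j) x = z → blockMap (L ^ j') x = z' → j = j' ∧ z = z' :=
  fun m hm j hj j' hj' z hz z' hz' x hx hx' =>
    towers_disjoint_of_lamTop hL i hlaws hΩ hΛ m hm j hj j' hj' z hz z' hz' x
      ((under_iff_blockMap_eq hL j z x).2 hx) ((under_iff_blockMap_eq hL j' z' x).2 hx')

/-! ## §2 The excluded shapes: READ-23's mechanism and LOCATED-SLET's all-`univ` datum -/

/-- ★ **READ-23's MECHANISM IS EXCLUDED**: under `DomainSeq` + the located laws, the (1.5)-reading `LamTop` forbids «`Λs k 0 = ℤᵈ` together with a level-`1` top»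
(`k ≥ 1`) — the corner `L•z′` of a level-`1` top `z′` would be a level-`0` top under itself AND under `z′`. This is the shape behind ref-A g15 READ-23 and dag-n05-w1
LOCATED-SLET (the letter `H′` cannot match arbitrary data on both). [cite: Balaban1985RegularSpaces, (1.5)–(1.6) p.77, (1.91)–(1.92) p.91] -/
theorem not_lamTop_of_univ_zero_of_top_one (hL : 1 ≤ L) (i : ZdIdx d L) (hlaws : IdxB8Laws L i) (hΩ : DomainSeq L i.Ω) (hk : 1 ≤ i.k)
    (h0 : i.Λs i.k 0 = Set.univ) (h1 : (i.Λs i.k 1).Nonempty) :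
    ¬ ∀ j, j < i.k → ∀ z ∈ i.Λs i.k j, ((L : ℤ) ^ j) • z ∈ Lam L i.Ω j := by
  intro hΛ
  obtain ⟨z', hz'⟩ := h1
  have hx0 : Under L 0 (((L : ℤ) ^ 1) • z') (((L : ℤ) ^ 1) • z') := by
    have h := under_smul_self hL 0 (((L : ℤ) ^ 1) • z')
    rwa [pow_zero, one_smul] at h
  have h := towers_disjoint_top_of_lamTop hL i hlaws hΩ hΛ 0 (Nat.zero_le _) 1 hk (((L : ℤ) ^ 1) • z') (by rw [h0]; exact Set.mem_univ _)
    z' hz' _ hx0 (under_smul_self hL 1 z')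
  exact absurd h.1 (by omega)

/-- **LOCATED-SLET's DATUM IS EXCLUDED, with no hypothesis beyond the datum**: if `Ω₁ = ℤᵈ` then `Λ₀ = Ω₀^{(0)} ∖ Ω₁^{(0)} = ∅`, so a member with `k ≥ 1` and a
level-`0` top (e.g. dag-n05-w1's all-`univ` `i⋆`: `k = 1`, `Ω_j = Λs m j = ℤᵈ`) violates `LamTop`. [cite: Balaban1985RegularSpaces, (1.5) p.77] -/
theorem not_lamTop_of_omega_one_univ (i : ZdIdx d L) (hk : 1 ≤ i.k) (hΩ1 : i.Ω 1 = Set.univ) (h0 : (i.Λs i.k 0).Nonempty) :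
    ¬ ∀ j, j < i.k → ∀ z ∈ i.Λs i.k j, ((L : ℤ) ^ j) • z ∈ Lam L i.Ω j := by
  intro hΛ
  obtain ⟨z, hz⟩ := h0
  have h := (hΛ 0 (by omega) z hz).2.2
  rw [Nat.zero_add, hΩ1] at h
  exact h (Set.mem_univ _)

end Literature.MathematicalPhysics.QuantumFieldTheory.Balaban1983to89.B8IdxB8LamTopTowerDisjoint
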